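import Summits.Ventures.CertifiedManyBodySolver.Rows.HalfFilledTorusSignRuleRows
import HarnessLib

/-!
# Certificate rows with Shen–Qiu–Tian SIGN-RULE terms (`signrule`) on the even half-filled torus, II:
# observable window rows (R2), both directions

HONEST FRAMING: first certified bounds; not a superconductivity verdict; every number certified or labelled float.

Rows part of the M2 vocabulary (unit sr-mbsolver-m2-4; sign-rule WINDOW edge asked for by
sr-mbsolver-m2-3). Instances of the master `re_expect_halfFilledGS_ge_of_windowCertificate_gsNonneg` of
part I (`Rows/HalfFilledTorusSignRuleRows.lean`) on `hubbardTorus 2 L t U`, `L` even, `t ≠ 0`, `U > 0`,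
half filling `n = 1`, menu `singletSectorAnn (L²)`, energy window `μ (E_up − H) + ν (H − E_lo)` with
CERTIFIED `E_lo ≤ E₀(L²) ≤ E_up`, residual `R + δ·1 ⪰ 0`:
* `re_expect_halfFilledGS_ge_of_windowCertificate_signRule` / `…_le_…`: nonnegative side
  `SOS + window + (Σ_r ν_r (ε_{x_r} ε_{y_r}) • 𝐒_{x_r}·𝐒_{y_r} + R)`, `ν_r ≥ 0` — conclusion
  `c − δ ≤ Re ⟨ψ, V ψ⟩` (resp. `Re ⟨ψ, V ψ⟩ ≤ −c + δ` from a certificate for `−V`) for every normalised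
  `(L², S^z = 0)` sector ground state `ψ` (at half filling: THE ground state);
* `re_expect_halfFilledGS_ge_of_windowCertificate_liebGram_signRule` / `…_le_…`: the Lieb forms
  `liebForm torusSign G w + liebFormFlip torusSign G' w'` (`G, G' ⪰ 0`) AND the sign-rule sum in one
  identity — the augmented window (liebgram + sign rule + singlet menu) of sr-mbsolver-m2-3's census.
The sign-rule sum is NOT operator-positive; only its ground-state value is signed
(`hubbardTorus_re_expect_signRuleSum_nonneg`), which is exactly what a ground-state window row needs.

NOTE for certificate files (as in part I / `LiebGramRows`): elaborate the identity with the order-derived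
`DecidableEq (FermionTorus 2 L)` (`LinearOrder.toDecidableEq`, the local instance of this file).

References: [cite: ShenQiuTian1994, Theorem and eqs. (7)–(9)]; [cite: Tian2004, §3];
[cite: LiebPRL1989, proof of Theorem 2]; [cite: WangEtAl2024, §3 eq. (4)]; [cite: KullEtAl2024, §5.3].
-/

noncomputable section

namespace Summit.Ventures.CertifiedManyBodySolver

open Matrix Finset Literature.MathematicalPhysics.QuantumLattice
  Literature.MathematicalPhysics.QuantumLattice.LiebTwo
  Literature.MathematicalPhysics.QuantumLattice.FermionSpinMoment
  Literature.MathematicalPhysics.QuantumManyBody.StateRelaxation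
  Summit.HubbardSuperconductivity.HubbardLadder
open scoped ComplexOrder MatrixOrder

section Torus

variable (L : ℕ) [NeZero L]

/-- (Local to this file, as in part I / `LiebGramRows`.) Equality of torus sites is decided through the
LINEAR ORDER. No library instance is overridden outside this file. [folklore] -/
local instance (priority := high) instDecidableEqFermionTorusSignRuleWindowRows :
    DecidableEq (FermionTorus 2 L) :=
  LinearOrder.toDecidableEq

variable {m : Type*} [Fintype m] [DecidableEq m]

/-- **Observable window row with sign-rule terms (R2 at `n = 1`, lower-bound form)**:
`V − c·1 = SOS + null + μ (E_up − H) + ν (H − E_lo) + (Σ_r ν_r (ε_{x_r} ε_{y_r}) • 𝐒_{x_r}·𝐒_{y_r} + R)`,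
`μ, ν, ν_r ≥ 0`, `E_lo ≤ E₀(L²) ≤ E_up`, `R + δ·1 ⪰ 0` ⟹ `c − δ ≤ Re ⟨ψ, V ψ⟩` for every normalised
`(L², S^z = 0)` sector ground state `ψ`. [cite: ShenQiuTian1994, Theorem and eqs. (7)–(9)]
[cite: WangEtAl2024, §3 eq. (4)] [cite: LiebPRL1989, proof of Theorem 2] -/
theorem re_expect_halfFilledGS_ge_of_windowCertificate_signRule (hL : Even L) {t U : ℝ}
    (ht : t ≠ 0) (hU : 0 < U) {Λm : Matrix m m ℂ} (hΛ : Λm.PosSemidef)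
    (O : m → Matrix (Finset (Orb (FermionTorus 2 L))) (Finset (Orb (FermionTorus 2 L))) ℂ)
    {κ : Type*} (s : Finset κ)
    (X : κ → Matrix (Finset (Orb (FermionTorus 2 L))) (Finset (Orb (FermionTorus 2 L))) ℂ)
    {ι : Type*} (t' : Finset ι)
    (Y Y' : ι → Matrix (Finset (Orb (FermionTorus 2 L))) (Finset (Orb (FermionTorus 2 L))) ℂ)
    (a a' : ι → Fin 4)
    {ρ : Type*} (sr : Finset ρ) {νs : ρ → ℝ} (hνs : ∀ r ∈ sr, 0 ≤ νs r)
    (x y : ρ → FermionTorus 2 L)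
    {R : Matrix (Finset (Orb (FermionTorus 2 L))) (Finset (Orb (FermionTorus 2 L))) ℂ} {δ : ℝ}
    (hR : (R + (δ : ℂ) • (1 : Matrix (Finset (Orb (FermionTorus 2 L))) _ ℂ)).PosSemidef)
    {V : Matrix (Finset (Orb (FermionTorus 2 L))) (Finset (Orb (FermionTorus 2 L))) ℂ}
    {Eup Elo μ ν c : ℝ} (hμ : 0 ≤ μ) (hν : 0 ≤ ν)
    (hup : groundEnergyAt (fermionTorusGraph 2 L) t U (L ^ 2) ≤ Eup)
    (hlo : Elo ≤ groundEnergyAt (fermionTorusGraph 2 L) t U (L ^ 2))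
    (hcert : V - (c : ℂ) • 1 =
      gramForm Λm O + (∑ k ∈ s, (hubbardTorus 2 L t U * X k - X k * hubbardTorus 2 L t U) +
        ∑ q ∈ t', (Y q * singletSectorAnn (L ^ 2) (a q) + singletSectorAnn (L ^ 2) (a' q) * Y' q)) +
        ((μ : ℂ) • ((Eup : ℂ) • 1 - hubbardTorus 2 L t U) +
          (ν : ℂ) • (hubbardTorus 2 L t U - (Elo : ℂ) • 1) +
          (∑ r ∈ sr, ((νs r : ℝ) : ℂ) •
              ((torusSign (x r) * torusSign (y r)) • fermionSpinDot (x r) (y r)) + R))) :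
    ∀ ψ : Fock (Orb (FermionTorus 2 L)), star ψ ⬝ᵥ ψ = 1 →
      IsGroundStateInSector (hubbardTorus 2 L t U) (L ^ 2) 0 ψ →
      c - δ ≤ (star ψ ⬝ᵥ V *ᵥ ψ).re :=
  re_expect_halfFilledGS_ge_of_windowCertificate_gsNonneg L hL ht hU hΛ O s X t' Y Y' a a'
    (fun _ hN hHφ => hubbardTorus_re_expect_signRuleSum_nonneg L hL ht hU hN hHφ sr hνs x y)
    hR hμ hν hup hlo hcert

/-- Upper-bound form of `re_expect_halfFilledGS_ge_of_windowCertificate_signRule`: a certificate for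
`−V − c·1` proves `Re ⟨ψ, V ψ⟩ ≤ −c + δ`. [cite: ShenQiuTian1994, Theorem and eqs. (7)–(9)]
[cite: WangEtAl2024, §3 eq. (4)] -/
theorem re_expect_halfFilledGS_le_of_windowCertificate_signRule (hL : Even L) {t U : ℝ}
    (ht : t ≠ 0) (hU : 0 < U) {Λm : Matrix m m ℂ} (hΛ : Λm.PosSemidef)
    (O : m → Matrix (Finset (Orb (FermionTorus 2 L))) (Finset (Orb (FermionTorus 2 L))) ℂ)
    {κ : Type*} (s : Finset κ)
    (X : κ → Matrix (Finset (Orb (FermionTorus 2 L))) (Finset (Orb (FermionTorus 2 L))) ℂ)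
    {ι : Type*} (t' : Finset ι)
    (Y Y' : ι → Matrix (Finset (Orb (FermionTorus 2 L))) (Finset (Orb (FermionTorus 2 L))) ℂ)
    (a a' : ι → Fin 4)
    {ρ : Type*} (sr : Finset ρ) {νs : ρ → ℝ} (hνs : ∀ r ∈ sr, 0 ≤ νs r)
    (x y : ρ → FermionTorus 2 L)
    {R : Matrix (Finset (Orb (FermionTorus 2 L))) (Finset (Orb (FermionTorus 2 L))) ℂ} {δ : ℝ}
    (hR : (R + (δ : ℂ) • (1 : Matrix (Finset (Orb (FermionTorus 2 L))) _ ℂ)).PosSemidef)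
    {V : Matrix (Finset (Orb (FermionTorus 2 L))) (Finset (Orb (FermionTorus 2 L))) ℂ}
    {Eup Elo μ ν c : ℝ} (hμ : 0 ≤ μ) (hν : 0 ≤ ν)
    (hup : groundEnergyAt (fermionTorusGraph 2 L) t U (L ^ 2) ≤ Eup)
    (hlo : Elo ≤ groundEnergyAt (fermionTorusGraph 2 L) t U (L ^ 2))
    (hcert : -V - (c : ℂ) • 1 =
      gramForm Λm O + (∑ k ∈ s, (hubbardTorus 2 L t U * X k - X k * hubbardTorus 2 L t U) +
        ∑ q ∈ t', (Y q * singletSectorAnn (L ^ 2) (a q) + singletSectorAnn (L ^ 2) (a' q) * Y' q)) +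
        ((μ : ℂ) • ((Eup : ℂ) • 1 - hubbardTorus 2 L t U) +
          (ν : ℂ) • (hubbardTorus 2 L t U - (Elo : ℂ) • 1) +
          (∑ r ∈ sr, ((νs r : ℝ) : ℂ) •
              ((torusSign (x r) * torusSign (y r)) • fermionSpinDot (x r) (y r)) + R))) :
    ∀ ψ : Fock (Orb (FermionTorus 2 L)), star ψ ⬝ᵥ ψ = 1 →
      IsGroundStateInSector (hubbardTorus 2 L t U) (L ^ 2) 0 ψ →
      (star ψ ⬝ᵥ V *ᵥ ψ).re ≤ -c + δ := by
  intro ψ h1 hgs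
  have h := re_expect_halfFilledGS_ge_of_windowCertificate_signRule L hL ht hU hΛ O s X t' Y Y' a a'
    sr hνs x y hR hμ hν hup hlo hcert ψ h1 hgs
  rw [neg_mulVec, dotProduct_neg, Complex.neg_re] at h
  linarith

/-- **Observable window row with Lieb Gram blocks AND sign-rule terms (R2 at `n = 1`, lower-bound form)**
— the augmented window of sr-mbsolver-m2-3's census (liebgram + sign rule + singlet menu together).
[cite: LiebPRL1989, proof of Theorem 2] [cite: ShenQiuTian1994, Theorem and eqs. (7)–(9)]
[cite: WangEtAl2024, §3 eq. (4)] [cite: KullEtAl2024, §5.3] -/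
theorem re_expect_halfFilledGS_ge_of_windowCertificate_liebGram_signRule (hL : Even L) {t U : ℝ}
    (ht : t ≠ 0) (hU : 0 < U) {Λm : Matrix m m ℂ} (hΛ : Λm.PosSemidef)
    (O : m → Matrix (Finset (Orb (FermionTorus 2 L))) (Finset (Orb (FermionTorus 2 L))) ℂ)
    {κ : Type*} (s : Finset κ)
    (X : κ → Matrix (Finset (Orb (FermionTorus 2 L))) (Finset (Orb (FermionTorus 2 L))) ℂ)
    {ι : Type*} (t' : Finset ι)
    (Y Y' : ι → Matrix (Finset (Orb (FermionTorus 2 L))) (Finset (Orb (FermionTorus 2 L))) ℂ)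
    (a a' : ι → Fin 4)
    {κ₁ : Type*} [Fintype κ₁] {Gm : Matrix κ₁ κ₁ ℂ} (hGm : Gm.PosSemidef)
    (w : κ₁ → List (FermionTorus 2 L × FermionTorus 2 L))
    {κ₂ : Type*} [Fintype κ₂] {Gm' : Matrix κ₂ κ₂ ℂ} (hGm' : Gm'.PosSemidef)
    (w' : κ₂ → List (FermionTorus 2 L × FermionTorus 2 L))
    {ρ : Type*} (sr : Finset ρ) {νs : ρ → ℝ} (hνs : ∀ r ∈ sr, 0 ≤ νs r)
    (x y : ρ → FermionTorus 2 L)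
    {R : Matrix (Finset (Orb (FermionTorus 2 L))) (Finset (Orb (FermionTorus 2 L))) ℂ} {δ : ℝ}
    (hR : (R + (δ : ℂ) • (1 : Matrix (Finset (Orb (FermionTorus 2 L))) _ ℂ)).PosSemidef)
    {V : Matrix (Finset (Orb (FermionTorus 2 L))) (Finset (Orb (FermionTorus 2 L))) ℂ}
    {Eup Elo μ ν c : ℝ} (hμ : 0 ≤ μ) (hν : 0 ≤ ν)
    (hup : groundEnergyAt (fermionTorusGraph 2 L) t U (L ^ 2) ≤ Eup)
    (hlo : Elo ≤ groundEnergyAt (fermionTorusGraph 2 L) t U (L ^ 2))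
    (hcert : V - (c : ℂ) • 1 =
      gramForm Λm O + (∑ k ∈ s, (hubbardTorus 2 L t U * X k - X k * hubbardTorus 2 L t U) +
        ∑ q ∈ t', (Y q * singletSectorAnn (L ^ 2) (a q) + singletSectorAnn (L ^ 2) (a' q) * Y' q)) +
        ((μ : ℂ) • ((Eup : ℂ) • 1 - hubbardTorus 2 L t U) +
          (ν : ℂ) • (hubbardTorus 2 L t U - (Elo : ℂ) • 1) +
          (liebForm torusSign Gm w + liebFormFlip torusSign Gm' w' +
            ∑ r ∈ sr, ((νs r : ℝ) : ℂ) •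
              ((torusSign (x r) * torusSign (y r)) • fermionSpinDot (x r) (y r)) + R))) :
    ∀ ψ : Fock (Orb (FermionTorus 2 L)), star ψ ⬝ᵥ ψ = 1 →
      IsGroundStateInSector (hubbardTorus 2 L t U) (L ^ 2) 0 ψ →
      c - δ ≤ (star ψ ⬝ᵥ V *ᵥ ψ).re :=
  re_expect_halfFilledGS_ge_of_windowCertificate_gsNonneg L hL ht hU hΛ O s X t' Y Y' a a'
    (fun _ hN hHφ => hubbardTorus_re_expect_liebForms_add_signRuleSum_nonneg L hL ht hU hN hHφ
      hGm w hGm' w' sr hνs x y) hR hμ hν hup hlo hcert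

/-- Upper-bound form of `re_expect_halfFilledGS_ge_of_windowCertificate_liebGram_signRule`: a
certificate for `−V − c·1` proves `Re ⟨ψ, V ψ⟩ ≤ −c + δ`. [cite: LiebPRL1989, proof of Theorem 2]
[cite: ShenQiuTian1994, Theorem and eqs. (7)–(9)] [cite: WangEtAl2024, §3 eq. (4)] -/
theorem re_expect_halfFilledGS_le_of_windowCertificate_liebGram_signRule (hL : Even L) {t U : ℝ}
    (ht : t ≠ 0) (hU : 0 < U) {Λm : Matrix m m ℂ} (hΛ : Λm.PosSemidef)
    (O : m → Matrix (Finset (Orb (FermionTorus 2 L))) (Finset (Orb (FermionTorus 2 L))) ℂ)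
    {κ : Type*} (s : Finset κ)
    (X : κ → Matrix (Finset (Orb (FermionTorus 2 L))) (Finset (Orb (FermionTorus 2 L))) ℂ)
    {ι : Type*} (t' : Finset ι)
    (Y Y' : ι → Matrix (Finset (Orb (FermionTorus 2 L))) (Finset (Orb (FermionTorus 2 L))) ℂ)
    (a a' : ι → Fin 4)
    {κ₁ : Type*} [Fintype κ₁] {Gm : Matrix κ₁ κ₁ ℂ} (hGm : Gm.PosSemidef)
    (w : κ₁ → List (FermionTorus 2 L × FermionTorus 2 L))
    {κ₂ : Type*} [Fintype κ₂] {Gm' : Matrix κ₂ κ₂ ℂ} (hGm' : Gm'.PosSemidef)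
    (w' : κ₂ → List (FermionTorus 2 L × FermionTorus 2 L))
    {ρ : Type*} (sr : Finset ρ) {νs : ρ → ℝ} (hνs : ∀ r ∈ sr, 0 ≤ νs r)
    (x y : ρ → FermionTorus 2 L)
    {R : Matrix (Finset (Orb (FermionTorus 2 L))) (Finset (Orb (FermionTorus 2 L))) ℂ} {δ : ℝ}
    (hR : (R + (δ : ℂ) • (1 : Matrix (Finset (Orb (FermionTorus 2 L))) _ ℂ)).PosSemidef)
    {V : Matrix (Finset (Orb (FermionTorus 2 L))) (Finset (Orb (FermionTorus 2 L))) ℂ}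
    {Eup Elo μ ν c : ℝ} (hμ : 0 ≤ μ) (hν : 0 ≤ ν)
    (hup : groundEnergyAt (fermionTorusGraph 2 L) t U (L ^ 2) ≤ Eup)
    (hlo : Elo ≤ groundEnergyAt (fermionTorusGraph 2 L) t U (L ^ 2))
    (hcert : -V - (c : ℂ) • 1 =
      gramForm Λm O + (∑ k ∈ s, (hubbardTorus 2 L t U * X k - X k * hubbardTorus 2 L t U) +
        ∑ q ∈ t', (Y q * singletSectorAnn (L ^ 2) (a q) + singletSectorAnn (L ^ 2) (a' q) * Y' q)) +
        ((μ : ℂ) • ((Eup : ℂ) • 1 - hubbardTorus 2 L t U) +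
          (ν : ℂ) • (hubbardTorus 2 L t U - (Elo : ℂ) • 1) +
          (liebForm torusSign Gm w + liebFormFlip torusSign Gm' w' +
            ∑ r ∈ sr, ((νs r : ℝ) : ℂ) •
              ((torusSign (x r) * torusSign (y r)) • fermionSpinDot (x r) (y r)) + R))) :
    ∀ ψ : Fock (Orb (FermionTorus 2 L)), star ψ ⬝ᵥ ψ = 1 →
      IsGroundStateInSector (hubbardTorus 2 L t U) (L ^ 2) 0 ψ →
      (star ψ ⬝ᵥ V *ᵥ ψ).re ≤ -c + δ := by
  intro ψ h1 hgs
  have h := re_expect_halfFilledGS_ge_of_windowCertificate_liebGram_signRule L hL ht hU hΛ O s X t'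
    Y Y' a a' hGm w hGm' w' sr hνs x y hR hμ hν hup hlo hcert ψ h1 hgs
  rw [neg_mulVec, dotProduct_neg, Complex.neg_re] at h
  linarith

end Torus

end Summit.Ventures.CertifiedManyBodySolver

end
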